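import Summits.NavierStokesRegularity.NavierStokesRegularity.Theorems.TerminalTraceTypeITraceScarL3SqrtTwoApexTimeLayer
import Summits.NavierStokesRegularity.NavierStokesRegularity.Theorems.TerminalTraceTypeITraceScarL3LogMeanCeiling
import HarnessLib

/-!
# The time layer of ROUND-28 «CEILING AND MEAN» (T28-A modulo shell data): the log-mean twin of
# `two_le_rateSq_of_shellData` (item `TerminalTrace.TypeITraceScarL3`, stmt-NavierStokesRegularity-18385; helper)

Planner plate (nsreg-p2 g29, composition duty (d) of DIRECTOR-NS #116 rev 3: «`…SqrtTwoWindow` closers incl.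
T28 log-mean variants»), to be landed by a prover seat `--supports stmt-NavierStokesRegularity-18385` (helper).

SETTING = that of `…SqrtTwoApexTimeLayer` (nsreg-C26-p1 g2): `V` jointly smooth on `]s₁, 0[`, divergence free,
classical unit-viscosity Navier–Stokes near every time with a gauge-free shell pressure budget `m_P` on the annulus
`K = {ρ₁ ≤ |y| ≤ ρ₂}`, smooth cut-off `φ`, sup bounds `B` on `K`, transported cubic FLOOR `E ≥ c√(−t)` and strong
EXTINCTION `E → 0`.  The ONLY change: the constant rate `C/√(−t)` on the support of `φ` is replaced by a
time-dependent rate `β(t)` with `β(t)² ≤ 2p(t)/(−t)` whose log-window means are at most `q` (slack `K₀`):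
`P(s) − P(s') ≤ q·log((−s')/(−s)) + K₀` for a primitive `P' = p/(−s)` — hypothesis (LM_q) of ROUND-28 §3.
Conclusion: `1 ≤ q` — the identity package of `…SqrtTwoApexTimeLayer` fed into the CHECKED log-mean calculus
`one_le_logMean_of_identities` (tree `…LogMeanCeiling`, nsreg-p2 g29 / nsreg-typer g30) instead of
`two_le_rateSq_of_identities`.  With `β ≡ C/√(−t)`, `p ≡ C²/2`, `P(s) = (C²/2)·log(1/(−s))`, `q = C²/2`, `K₀ = 0`
this is `two_le_rateSq_of_shellData` again (`corollary two_le_rateSq_of_shellData'` below, a consistency check).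

WHAT THIS IS NOT: not T28-C (the floor, the extinction, the annulus bounds, the shell pressure budget and the
transfer of (LM_q) through the zoom are hypotheses / elsewhere), not Stub LOUD, not NS regularity.
[folklore; Ghidaglia 1986; Agmon–Nirenberg 1967; Temam IDDS 1997 §III.6]
-/

noncomputable section

set_option linter.dupNamespace false

namespace Summit.NavierStokesRegularity.NavierStokesRegularity.Theorems.TypeITraceScarL3

open MeasureTheory Set Function Filter Topology Metric InnerProductSpace
open Literature.Analysis.FluidPDE
open scoped RealInnerProductSpace Laplacian ContDiff

variable {V : ℝ → EuclideanSpace ℝ (Fin 3) → EuclideanSpace ℝ (Fin 3)} {φ : EuclideanSpace ℝ (Fin 3) → ℝ}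
  {s₁ ρ₁ ρ₂ B Cφ mP : ℝ}

/-- **T28-A modulo shell data: `1 ≤ q`.**  In the setting of `two_le_rateSq_of_shellData` with the constant
rate replaced by a time-dependent rate `‖V(t, y)‖ ≤ β(t)` on the support of the cut-off, `β(t)² ≤ 2p(t)/(−t)`,
and log-window means of `p` at most `q` with slack `K₀` (hypothesis (LM_q): `P(s) − P(s') ≤ q log((−s')/(−s)) + K₀`
for a primitive `P' = p/(−s)` on `]s₁,0[`), the floor and the extinction force `1 ≤ q`.
[folklore; Ghidaglia 1986; Agmon–Nirenberg 1967; ROUND-28 §3 T28-A] -/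
theorem one_le_logMean_of_shellData (hs₁ : s₁ < 0)
    (hV : IsSmoothSpaceTimeOn (Ioo s₁ 0) V) (hdiv : ∀ t ∈ Ioo s₁ 0, VectorCalculus.IsDivFree (V t))
    (hwin : ∀ t ∈ Ioo s₁ 0, ∃ (a c : ℝ) (q : ℝ → EuclideanSpace ℝ (Fin 3) → ℝ), t ∈ Ioo a c ∧
      IsClassicalNSSolutionOn (Ioo a c) 1 0 V q ∧
      ∃ cst : ℝ, ∫ y in {y : EuclideanSpace ℝ (Fin 3) | ρ₁ ≤ ‖y‖ ∧ ‖y‖ ≤ ρ₂}, |q t y - cst| ≤ mP)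
    (hφ : ContDiff ℝ ∞ φ) (hφ1 : ∀ y : EuclideanSpace ℝ (Fin 3), ‖y‖ ≤ ρ₁ → φ y = 1)
    (hφ0 : ∀ y : EuclideanSpace ℝ (Fin 3), ρ₂ ≤ ‖y‖ → φ y = 0)
    (hφ01 : ∀ y, 0 ≤ φ y ∧ φ y ≤ 1) (hCφ : 0 ≤ Cφ) (hdφ : ∀ y, ‖fderiv ℝ φ y‖ ≤ Cφ) (hB : 0 ≤ B)
    (hmP : 0 ≤ mP)
    (hbd : ∀ t ∈ Ioo s₁ 0, ∀ y ∈ {y : EuclideanSpace ℝ (Fin 3) | ρ₁ ≤ ‖y‖ ∧ ‖y‖ ≤ ρ₂},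
      ‖V t y‖ ≤ B ∧ ‖(Δ (V t)) y‖ ≤ B ∧ ‖(Δ (fun y => φ y • V t y)) y‖ ≤ B ∧
        ‖fderiv ℝ (Δ (fun y => φ y • V t y)) y‖ ≤ B)
    {β p P : ℝ → ℝ} {q K₀ : ℝ} (hK₀ : 0 ≤ K₀)
    (hβ : ∀ t ∈ Ioo s₁ 0, 0 ≤ β t) (hrate : ∀ t ∈ Ioo s₁ 0, ∀ y ∈ tsupport φ, ‖V t y‖ ≤ β t)
    (hpβ : ∀ t ∈ Ioo s₁ 0, β t ^ 2 ≤ 2 * p t / (-t)) (hpnn : ∀ t ∈ Ioo s₁ 0, 0 ≤ p t)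
    (hP : ∀ t ∈ Ioo s₁ 0, HasDerivAt P (p t / (-t)) t)
    (hLM : ∀ s' ∈ Ioo s₁ 0, ∀ s ∈ Ioo s₁ 0, s' ≤ s → P s - P s' ≤ q * Real.log ((-s') / (-s)) + K₀)
    {c : ℝ} (hc : 0 < c) (hfloor : ∀ t ∈ Ioo s₁ 0, c * Real.sqrt (-t) ≤ ∫ y, ‖φ y • V t y‖ ^ 2)
    (hext : Tendsto (fun s => ∫ y, ‖φ y • V s y‖ ^ 2) (𝓝[<] 0) (𝓝 0)) :
    1 ≤ q := by
  have hφc : HasCompactSupport φ := hasCompactSupport_of_cutoff hφ0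
  have hEpos : ∀ t ∈ Ioo s₁ 0, 0 < ∫ y, ‖φ y • V t y‖ ^ 2 := fun t ht =>
    lt_of_lt_of_le (mul_pos hc (Real.sqrt_pos.2 (by linarith [ht.2]))) (hfloor t ht)
  refine one_le_logMean_of_identities
    (E := fun s => ∫ y, ‖φ y • V s y‖ ^ 2)
    (D := fun s => ∫ y, frobeniusNormSq (fderiv ℝ (fun y => φ y • V s y) y))
    (Q₀ := fun s => ∫ y, ‖(Δ (fun y => φ y • V s y)) y‖ ^ 2)
    (S₁ := fun s => (∫ y, frobeniusNormSq (fderiv ℝ (fun y => φ y • V s y) y)) +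
      ∫ y, ⟪φ y • V s y, φ y • deriv (fun r => V r y) s⟫)
    (X := fun s => ∫ y, ⟪(Δ (fun y => φ y • V s y)) y +
        ((∫ y, frobeniusNormSq (fderiv ℝ (fun y => φ y • V s y) y)) / ∫ y, ‖φ y • V s y‖ ^ 2) •
          (φ y • V s y), convect (V s) (fun y => φ y • V s y) y⟫)
    (S₂ := fun s => (∫ y, ⟪(Δ (fun y => φ y • V s y)) y, φ y • deriv (fun r => V r y) s⟫) -
      (∫ y, ‖(Δ (fun y => φ y • V s y)) y‖ ^ 2) +
      ∫ y, ⟪(Δ (fun y => φ y • V s y)) y +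
        ((∫ y, frobeniusNormSq (fderiv ℝ (fun y => φ y • V s y) y)) / ∫ y, ‖φ y • V s y‖ ^ 2) •
          (φ y • V s y), convect (V s) (fun y => φ y • V s y) y⟫)
    (β := β) (p := p) (P := P)
    (m₁ := (2 * B ^ 2 + Cφ * B ^ 3) *
        (volume {y : EuclideanSpace ℝ (Fin 3) | ρ₁ ≤ ‖y‖ ∧ ‖y‖ ≤ ρ₂}).toReal + 2 * Cφ * B * mP)
    (m₂ := (2 * B ^ 2 + Cφ * B ^ 3) *
        (volume {y : EuclideanSpace ℝ (Fin 3) | ρ₁ ≤ ‖y‖ ∧ ‖y‖ ≤ ρ₂}).toReal + (3 + Cφ) * B * mP)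
    hs₁ hc (by positivity) (by positivity) hK₀ hfloor ?_ ?_ ?_ ?_ ?_ ?_ hpnn hP hLM ?_ ?_ hext
  · intro s _
    exact integral_nonneg fun y => frobeniusNormSq_nonneg _
  · intro s hs
    exact sq_integral_frobeniusNormSq_le (hφ.smul (hV.contDiff_slice hs)) hφc.smul_right
  · intro s hs
    exact hasDerivAt_cutoffEnergy_shell hV hφ hφc hs
  · intro s hs
    exact hasDerivAt_cutoffEnstrophy_shell hV hφ hφc hs _ _
  · intro s hs
    exact abs_energySource_le hs hV (hdiv s hs) (hwin s hs) hφ hφ1 hφ0 hφ01 hCφ hdφ hB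
      fun y hy => ⟨(hbd s hs y hy).1, (hbd s hs y hy).2.1, (hbd s hs y hy).2.2.1⟩
  · intro s hs
    exact abs_enstrophySource_le hs hV (hdiv s hs) (hwin s hs) hφ hφ1 hφ0 hφ01 hCφ hdφ hB (hbd s hs) _
  · intro s hs
    exact ⟨hβ s hs, hpβ s hs⟩
  · intro s hs
    -- Ghidaglia's drift bound at the fixed time `s` with the constant `β s · √(−s)`, so that
    -- `(β s · √(−s)) / √(−s) = β s`.
    have hsq : 0 < Real.sqrt (-s) := Real.sqrt_pos.2 (by linarith [hs.2])
    have hCs : 0 ≤ β s * Real.sqrt (-s) := mul_nonneg (hβ s hs) hsq.le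
    have hrate' : ∀ y ∈ tsupport φ, ‖V s y‖ ≤ β s * Real.sqrt (-s) / Real.sqrt (-s) := by
      intro y hy
      rw [mul_div_cancel_right₀ _ hsq.ne']
      exact hrate s hs y hy
    have h := abs_drift_le hs hV hφ hφc hCs hrate' (hEpos s hs)
    rwa [mul_div_cancel_right₀ _ hsq.ne'] at h

/-- Consistency check: the constant-rate case `β ≡ C/√(−t)`, `p ≡ C²/2`, `P(s) = −(C²/2)·log(−s)`, `q = C²/2`,
`K₀ = 0` of `one_le_logMean_of_shellData` is `two_le_rateSq_of_shellData` (`2 ≤ C²`). -/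
theorem two_le_rateSq_of_shellData' (hs₁ : s₁ < 0)
    (hV : IsSmoothSpaceTimeOn (Ioo s₁ 0) V) (hdiv : ∀ t ∈ Ioo s₁ 0, VectorCalculus.IsDivFree (V t))
    (hwin : ∀ t ∈ Ioo s₁ 0, ∃ (a c : ℝ) (q : ℝ → EuclideanSpace ℝ (Fin 3) → ℝ), t ∈ Ioo a c ∧
      IsClassicalNSSolutionOn (Ioo a c) 1 0 V q ∧
      ∃ cst : ℝ, ∫ y in {y : EuclideanSpace ℝ (Fin 3) | ρ₁ ≤ ‖y‖ ∧ ‖y‖ ≤ ρ₂}, |q t y - cst| ≤ mP)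
    (hφ : ContDiff ℝ ∞ φ) (hφ1 : ∀ y : EuclideanSpace ℝ (Fin 3), ‖y‖ ≤ ρ₁ → φ y = 1)
    (hφ0 : ∀ y : EuclideanSpace ℝ (Fin 3), ρ₂ ≤ ‖y‖ → φ y = 0)
    (hφ01 : ∀ y, 0 ≤ φ y ∧ φ y ≤ 1) (hCφ : 0 ≤ Cφ) (hdφ : ∀ y, ‖fderiv ℝ φ y‖ ≤ Cφ) (hB : 0 ≤ B)
    (hmP : 0 ≤ mP)
    (hbd : ∀ t ∈ Ioo s₁ 0, ∀ y ∈ {y : EuclideanSpace ℝ (Fin 3) | ρ₁ ≤ ‖y‖ ∧ ‖y‖ ≤ ρ₂},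
      ‖V t y‖ ≤ B ∧ ‖(Δ (V t)) y‖ ≤ B ∧ ‖(Δ (fun y => φ y • V t y)) y‖ ≤ B ∧
        ‖fderiv ℝ (Δ (fun y => φ y • V t y)) y‖ ≤ B)
    {C : ℝ} (hC : 0 ≤ C) (hrate : ∀ t ∈ Ioo s₁ 0, ∀ y ∈ tsupport φ, ‖V t y‖ ≤ C / Real.sqrt (-t))
    {c : ℝ} (hc : 0 < c) (hfloor : ∀ t ∈ Ioo s₁ 0, c * Real.sqrt (-t) ≤ ∫ y, ‖φ y • V t y‖ ^ 2)
    (hext : Tendsto (fun s => ∫ y, ‖φ y • V s y‖ ^ 2) (𝓝[<] 0) (𝓝 0)) :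
    2 ≤ C ^ 2 := by
  have h := one_le_logMean_of_shellData (β := fun t => C / Real.sqrt (-t)) (p := fun _ => C ^ 2 / 2)
    (P := fun s => -(C ^ 2 / 2) * Real.log (-s)) (q := C ^ 2 / 2) (K₀ := 0)
    hs₁ hV hdiv hwin hφ hφ1 hφ0 hφ01 hCφ hdφ hB hmP hbd le_rfl
    (fun t _ => div_nonneg hC (Real.sqrt_nonneg _)) hrate ?_ (fun t _ => by positivity) ?_ ?_ hc hfloor hext
  · linarith
  · intro t ht
    have ht0 : 0 < -t := by linarith [ht.2]
    rw [div_pow, Real.sq_sqrt ht0.le]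
    apply le_of_eq
    field_simp
  · intro t ht
    have ht0 : 0 < -t := by linarith [ht.2]
    have h1 : HasDerivAt (fun s : ℝ => -s) (-1) t := (hasDerivAt_id' t).neg
    have h2 : HasDerivAt (fun s : ℝ => Real.log (-s)) ((-1) / (-t)) t := h1.log ht0.ne'
    have h3 := h2.const_mul (-(C ^ 2 / 2))
    refine h3.congr_deriv ?_
    ring
  · intro s' hs' s hs hle
    have hs0 : 0 < -s := by linarith [hs.2]
    have hs'0 : 0 < -s' := by linarith [hs'.2]
    rw [Real.log_div hs'0.ne' hs0.ne']
    have : -(C ^ 2 / 2) * Real.log (-s) - -(C ^ 2 / 2) * Real.log (-s') =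
        C ^ 2 / 2 * (Real.log (-s') - Real.log (-s)) := by ring
    rw [this]
    linarith

end Summit.NavierStokesRegularity.NavierStokesRegularity.Theorems.TypeITraceScarL3

end
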